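import Literature.Analysis.FluidPDE.ChaeWolfDSSDecayScaling
import Literature.Analysis.FluidPDE.SuitableWeak
import HarnessLib

/-!
# Chae–Wolf 2017, Theorem 1.1 — from local bounds at the top points of an annulus to Type I

Analysis/FluidPDE proofs file (theorems only; no definitions, no named facts) on the discharge
path of the named fact `Literature.Analysis.FluidPDE.chaeWolf2017_dss_typeI_decay`
(`ChaeWolfRemovingDSS.lean`; D. Chae, J. Wolf, *Removing discretely self-similar singularities
for the 3D Navier–Stokes equations*, Comm. PDE 42 (2017) = arXiv:1610.09464, Thm. 1.1). It
renders the passage from Step 4 to Step 5 of the printed proof (arXiv p. 7):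

> "4. Regularity in `Q̄ ∖ {0,0}`: It suffices to show that every point `z₀ = (x₀, 0) ≠ (0,0)` is
> a regular point. […] 5. According to the step 4., where we have shown that `u` is bounded in
> any set `ℝ³ × (−∞,0) ∖ Q(0,r)` it holds `|u(x,t)| ≤ C ∀ (x,t) ∈ Q̄(0,λ) ∖ Q(0,1)`"

as the following bookkeeping, for a `c`-discretely self-similar field `u` (`1 < c`) continuous
on `(−∞, 0) × E`:

* `ChaeWolfDecay.exists_uniform_bound_annulus` — **compactness**: if every point `x₀` of the
  closed annulus `A = {a ≤ ‖x‖ ≤ ca}` is the vertex of a backward cylinder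
  `Q_r(0, x₀) = (−r², 0) × B(x₀, r)` on which `u` is bounded, then `u` is bounded on
  `(−δ, 0) × A` for some `δ > 0` (finite subcover of the compact annulus);
* `ChaeWolfDecay.farField_bound_of_annulus_bound` — **discrete self-similarity**: a bound `M ≥ 0`
  on `(−δ, 0) × A` propagates to `(−δ, 0) × {‖y‖ > a}`, since every `y` with `‖y‖ > a` is
  `cⁿ y'` with `y' ∈ A`, `n ≥ 0`, and `‖u(s, y)‖ = c⁻ⁿ ‖u(c⁻²ⁿ s, y')‖ ≤ M`;
* `ChaeWolfDecay.exists_hasTypeIDecay_of_local_bounds` — **conclusion**: under the hypothesis of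
  the first item, `HasTypeIDecay C u` for some `C`, by the accepted Step 5
  (`exists_hasTypeIDecay_of_farField_bound`, `ChaeWolfDSSDecayScaling.lean`);
* `IsClassicalNSSolutionOn.exists_hasTypeIDecay_of_local_bounds` — the same for classical
  solutions on `(−∞, 0)` (continuity is automatic), with the local bounds in the form delivered
  by the regularity criterion at a top point (`exists_bound_near_top_of_classical_Iio`,
  `ClassicalTopPointCubic.lean`): `∀ w ∈ parabolicCylinder r (0, x₀), ‖u w.1 w.2‖ ≤ M`.

## References

* D. Chae, J. Wolf, arXiv:1610.09464, proof of Thm. 1.1 (= Thm. 1.3 in the arXiv numbering),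
  Steps 4–5 (p. 7). [ChaeWolf2017RemovingDSS]
-/

noncomputable section

open Set Function Filter Metric
open _root_.Topology

namespace Literature.Analysis.FluidPDE

namespace ChaeWolfDecay

variable {E F : Type*} [NormedAddCommGroup E] [NormedSpace ℝ E]
  [NormedAddCommGroup F] [NormedSpace ℝ F]

/-! ### Compactness of the annulus -/

omit [NormedSpace ℝ E] in
/-- The closed annulus `{a ≤ ‖x‖ ≤ b}` of a proper space is compact. [folklore] -/
theorem isCompact_annulus [ProperSpace E] (a b : ℝ) :
    IsCompact {x : E | a ≤ ‖x‖ ∧ ‖x‖ ≤ b} := by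
  have hsub : {x : E | a ≤ ‖x‖ ∧ ‖x‖ ≤ b} ⊆ closedBall (0 : E) b := fun x hx => by
    rw [mem_closedBall, dist_zero_right]; exact hx.2
  have hclosed : IsClosed {x : E | a ≤ ‖x‖ ∧ ‖x‖ ≤ b} :=
    (isClosed_le continuous_const continuous_norm).inter (isClosed_le continuous_norm continuous_const)
  exact (isCompact_closedBall (0 : E) b).of_isClosed_subset hclosed hsub

omit [NormedSpace ℝ E] [NormedSpace ℝ F] in
/-- **Compactness step.** If every point `x₀` of the closed annulus `{a ≤ ‖x‖ ≤ b}` is the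
vertex of a cylinder `(−r², 0) × B(x₀, r)`, `r > 0`, on which `‖u‖ ≤ M(x₀)`, then `‖u‖ ≤ M` on
`(−δ, 0) × {a ≤ ‖x‖ ≤ b}` for some `δ > 0` and `M ≥ 0` (finite subcover). [folklore] -/
theorem exists_uniform_bound_annulus [ProperSpace E] {u : ℝ → E → F} {a b : ℝ}
    (hloc : ∀ x₀ : E, a ≤ ‖x₀‖ → ‖x₀‖ ≤ b → ∃ r > 0, ∃ M : ℝ,
      ∀ w ∈ parabolicCylinder r ((0 : ℝ), x₀), ‖u w.1 w.2‖ ≤ M) :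
    ∃ δ > 0, ∃ M : ℝ, 0 ≤ M ∧ ∀ s ∈ Ioo (-δ) 0, ∀ y : E, a ≤ ‖y‖ → ‖y‖ ≤ b → ‖u s y‖ ≤ M := by
  set A : Set E := {x : E | a ≤ ‖x‖ ∧ ‖x‖ ≤ b} with hA
  have hAc : IsCompact A := isCompact_annulus a b
  -- radii and bounds at each point of `A`
  choose! r hr M hM using fun x₀ (hx : x₀ ∈ A) => hloc x₀ hx.1 hx.2
  obtain ⟨t, htA, htfin, hcov⟩ : ∃ t : Set E, t ⊆ A ∧ t.Finite ∧ A ⊆ ⋃ x ∈ t, ball x (r x) :=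
    hAc.elim_finite_subcover_image (b := A) (c := fun x => ball x (r x))
      (fun x _ => isOpen_ball) fun x hx => mem_iUnion₂.2 ⟨x, hx, mem_ball_self (hr x hx)⟩
  rcases t.eq_empty_or_nonempty with ht | ht
  · -- empty cover: the annulus is empty
    refine ⟨1, one_pos, 0, le_rfl, fun s _ y hy1 hy2 => ?_⟩
    have : y ∈ A := ⟨hy1, hy2⟩
    have := hcov this
    simp [ht] at this
  · obtain ⟨i₀, hi₀, hmin⟩ := t.exists_min_image (fun x => r x) htfin ht
    obtain ⟨j₀, hj₀, hmax⟩ := t.exists_max_image (fun x => M x) htfin ht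
    have hδ : 0 < (r i₀) ^ 2 := pow_pos (hr i₀ (htA hi₀)) 2
    refine ⟨(r i₀) ^ 2, hδ, max (M j₀) 0, le_max_right _ _, fun s hs y hy1 hy2 => ?_⟩
    obtain ⟨i, hi, hyi⟩ : ∃ i ∈ t, y ∈ ball i (r i) := by
      have := hcov (show y ∈ A from ⟨hy1, hy2⟩)
      simpa only [mem_iUnion, exists_prop] using this
    have hri : r i₀ ≤ r i := hmin i hi
    have hw : (s, y) ∈ parabolicCylinder (r i) ((0 : ℝ), i) := by
      rw [mem_parabolicCylinder]
      refine ⟨⟨?_, by simpa using hs.2⟩, by simpa using hyi⟩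
      have h1 : (r i₀) ^ 2 ≤ (r i) ^ 2 := pow_le_pow_left₀ (hr i₀ (htA hi₀)).le hri 2
      simp only [zero_sub]
      linarith [hs.1]
    calc ‖u s y‖ ≤ M i := hM i (htA hi) (s, y) hw
      _ ≤ M j₀ := hmax i hi
      _ ≤ max (M j₀) 0 := le_max_left _ _

/-! ### Discrete self-similarity: from the annulus to the far field -/

/-- **From one annulus to the far field by discrete self-similarity.** Let `u` be `c`-DSS,
`1 < c`, `0 < a`, and `‖u‖ ≤ M`, `M ≥ 0`, on `(−δ, 0) × {a ≤ ‖y‖ ≤ ca}`. Then `‖u‖ ≤ M` on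
`(−δ, 0) × {‖y‖ > a}`: for `‖y‖/a ∈ [cⁿ, cⁿ⁺¹)`, `n ≥ 0`, one has
`u(s, y) = c⁻ⁿ u(c⁻²ⁿ s, c⁻ⁿ y)` with `c⁻ⁿ y` in the annulus and `c⁻²ⁿ s ∈ (−δ, 0)` (Chae–Wolf
2017, Step 5: "`|u(x,t)| = |u_{λ^{-k}}(x,t)| = λ^{-k}|u(λ^{-k}x, λ^{-2k}t)| ≤ λ^{-k} C`"). [cite: ChaeWolf2017RemovingDSS, proof of Thm. 1.1, Step 5 (arXiv p. 7)] -/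
theorem farField_bound_of_annulus_bound {c : ℝ} (hc : 1 < c) {u : ℝ → E → F}
    (h : IsDiscretelySelfSimilar c u) {a δ M : ℝ} (ha : 0 < a) (hM : 0 ≤ M)
    (hbd : ∀ s ∈ Ioo (-δ) 0, ∀ y : E, a ≤ ‖y‖ → ‖y‖ ≤ c * a → ‖u s y‖ ≤ M) :
    ∀ s ∈ Ioo (-δ) 0, ∀ y : E, a < ‖y‖ → ‖u s y‖ ≤ M := by
  intro s hs y hy
  have hc0 : 0 < c := one_pos.trans hc
  have hy0 : 0 < ‖y‖ := ha.trans hy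
  set ρ : ℝ := ‖y‖ / a with hρ
  have hρ1 : 1 < ρ := by rw [hρ, one_lt_div ha]; exact hy
  obtain ⟨n, hn1, hn2⟩ := exists_mem_Ico_zpow (one_pos.trans hρ1) hc
  -- `n ≥ 0`
  have hn0 : 0 ≤ n := by
    have h1 : 1 < c ^ (n + 1) := hρ1.trans hn2
    rw [one_lt_zpow_iff_right₀ hc] at h1
    omega
  -- the scaling factor `γ = c⁻ⁿ ≤ 1`
  have hγ0 : 0 < c ^ (-n) := zpow_pos hc0 _
  have hγ1 : c ^ (-n) ≤ 1 := zpow_le_one_of_nonpos₀ hc.le (neg_nonpos.2 hn0)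
  have hγn : c ^ (-n) * c ^ n = 1 := by rw [← zpow_add₀ hc0.ne', neg_add_cancel, zpow_zero]
  -- the rescaled point lies in `(−δ, 0) × {a ≤ ‖·‖ ≤ ca}`
  have hs' : (c ^ (-n)) ^ 2 * s ∈ Ioo (-δ) 0 := by
    refine ⟨?_, mul_neg_of_pos_of_neg (pow_pos hγ0 2) hs.2⟩
    have h1 : (c ^ (-n)) ^ 2 ≤ 1 := pow_le_one₀ hγ0.le hγ1
    nlinarith [hs.1, hs.2]
  have hy' : a ≤ ‖c ^ (-n) • y‖ ∧ ‖c ^ (-n) • y‖ ≤ c * a := by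
    rw [norm_smul, Real.norm_of_nonneg hγ0.le]
    have e : ‖y‖ = ρ * a := by rw [hρ, div_mul_cancel₀ _ ha.ne']
    rw [e]
    constructor
    · -- `a ≤ c⁻ⁿ ρ a` iff `cⁿ ≤ ρ`
      calc a = c ^ (-n) * (c ^ n * a) := by rw [← mul_assoc, hγn, one_mul]
        _ ≤ c ^ (-n) * (ρ * a) :=
          mul_le_mul_of_nonneg_left (mul_le_mul_of_nonneg_right hn1 ha.le) hγ0.le
    · -- `c⁻ⁿ ρ a ≤ c a` iff `ρ ≤ cⁿ⁺¹`
      calc c ^ (-n) * (ρ * a) ≤ c ^ (-n) * (c ^ (n + 1) * a) :=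
            mul_le_mul_of_nonneg_left (mul_le_mul_of_nonneg_right hn2.le ha.le) hγ0.le
        _ = c * a := by rw [zpow_add_one₀ hc0.ne', ← mul_assoc, ← mul_assoc, hγn, one_mul]
  have key := hbd _ hs' _ hy'.1 hy'.2
  rw [norm_eq_zpow_mul_norm hc0 h (-n) s y]
  calc c ^ (-n) * ‖u ((c ^ (-n)) ^ 2 * s) (c ^ (-n) • y)‖ ≤ c ^ (-n) * M :=
        mul_le_mul_of_nonneg_left key hγ0.le
    _ ≤ 1 * M := mul_le_mul_of_nonneg_right hγ1 hM
    _ = M := one_mul M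

/-! ### Conclusion -/

/-- **Local bounds at the top points of one annulus give the Type I bound** (Chae–Wolf 2017,
Steps 4–5). Let `u` be `c`-DSS (`1 < c`), continuous on `(−∞, 0) × E`, `0 < a`, and suppose every
point `x₀` with `a ≤ ‖x₀‖ ≤ ca` is the vertex of a backward cylinder `Q_r(0, x₀)`, `r > 0`, on
which `u` is bounded. Then `‖u(t, x)‖ ≤ C / (‖x‖ + √(−t))` for all `t < 0`, `x`, for some `C`. [cite: ChaeWolf2017RemovingDSS, proof of Thm. 1.1, Steps 4–5 (arXiv p. 7)] -/
theorem exists_hasTypeIDecay_of_local_bounds [ProperSpace E] {c : ℝ} (hc : 1 < c)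
    {u : ℝ → E → F} (h : IsDiscretelySelfSimilar c u)
    (hcont : ContinuousOn (uncurry u) (Iio 0 ×ˢ univ)) {a : ℝ} (ha : 0 < a)
    (hloc : ∀ x₀ : E, a ≤ ‖x₀‖ → ‖x₀‖ ≤ c * a → ∃ r > 0, ∃ M : ℝ,
      ∀ w ∈ parabolicCylinder r ((0 : ℝ), x₀), ‖u w.1 w.2‖ ≤ M) :
    ∃ C : ℝ, HasTypeIDecay C u := by
  obtain ⟨δ, hδ, M, hM0, hM⟩ := exists_uniform_bound_annulus hloc
  exact exists_hasTypeIDecay_of_farField_bound hc h hcont hδ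
    (farField_bound_of_annulus_bound hc h ha hM0 hM)

end ChaeWolfDecay

/-- **Chae–Wolf 2017, Theorem 1.1, reduced to the regularity of the top points of one annulus**:
for a `c`-DSS classical solution of Navier–Stokes on `(−∞, 0) × E` (any viscosity and force) and
`0 < a`, if every `x₀` with `a ≤ ‖x₀‖ ≤ ca` is the vertex of a cylinder `Q_r(0, x₀)`, `r > 0`, on
which `u` is bounded, then `u` satisfies a Type I bound `‖u(t,x)‖ ≤ C/(‖x‖ + √(−t))`. [cite: ChaeWolf2017RemovingDSS, Thm. 1.1, proof Steps 4–5 (arXiv p. 7)] -/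
theorem IsClassicalNSSolutionOn.exists_hasTypeIDecay_of_local_bounds
    {E : Type*} [NormedAddCommGroup E] [InnerProductSpace ℝ E] [FiniteDimensional ℝ E]
    [MeasurableSpace E] [BorelSpace E] {ν c : ℝ} (hc : 1 < c)
    {f u : ℝ → E → E} {p : ℝ → E → ℝ} (hsol : IsClassicalNSSolutionOn (Iio 0) ν f u p)
    (h : IsDiscretelySelfSimilar c u) {a : ℝ} (ha : 0 < a)
    (hloc : ∀ x₀ : E, a ≤ ‖x₀‖ → ‖x₀‖ ≤ c * a → ∃ r > 0, ∃ M : ℝ,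
      ∀ w ∈ parabolicCylinder r ((0 : ℝ), x₀), ‖u w.1 w.2‖ ≤ M) :
    ∃ C : ℝ, HasTypeIDecay C u :=
  haveI : ProperSpace E := FiniteDimensional.proper ℝ E
  ChaeWolfDecay.exists_hasTypeIDecay_of_local_bounds hc h hsol.smooth_velocity.continuousOn ha hloc

end Literature.Analysis.FluidPDE

end
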